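import Literature.Geometry.Kaehler.DeRhamFiniteUnion
import HarnessLib

/-!
# Finite-dimensionality of the de Rham cohomology of a compact manifold

Support for — in fact the proof of — the finite-dimensionality of de Rham cohomology
(`Literature.AlgebraicGeometry.Motives.finite_deRhamCohomology`), metric-free, for the chart-wise
de Rham complex `Literature.Geometry.Kaehler.deRhamCohomology I M F k` of `ManifoldForms`.

* `RelFinite.union`: the relative finiteness property (`Literature.Geometry.Kaehler.RelFinite`:
  finite-dimensional images `H^k(W') → H^k(W)` for `W` relatively compact in `W' ⊆ U`) passes
  from open `U`, `V` to `U ∪ V`. Proof ("three rows"): shrink twice, `(U, V) ⊇ (A, B) ⊇ (P, Q)`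
  with compact closures, around a splitting of the compact closure of `W`; a class on `W'`
  restricted to `A` and `B` lands in finite-dimensional images (relative finiteness of `U`, `V`);
  a class dying on `A` and `B` restricts on `P ∪ Q` to `δ` of the restriction to `P ∩ Q` of a
  class on `A ∩ B` (`LocalDeRham.exists_delta_eq_res`), and the image of
  `H(A ∩ B) → H(P ∩ Q)` is finite-dimensional (relative finiteness of `U` again, `A ∩ B ⊆ U`);
  linear algebra (`finite_range_of_finite_quotient_of_finite_map`) concludes. This replaces the
  good covers of Bott–Tu (1982), Prop. 5.3.1, which would need geodesically convex
  neighbourhoods.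
* `relFinite_univ`: a compact manifold is a finite union of chart sources, each relatively
  finite (`relFinite_of_subset_source`), hence `univ` is relatively finite; with `W = W' = univ`
  this is `finite_localDeRham_univ`, and by the comparison of `LocalForms`,
  `moduleFinite_deRhamCohomology_of_compactSpace`: **`H^k_dR(M; F)` is finite-dimensional for a compact
  boundaryless Hausdorff `C^∞` manifold `M` on a finite-dimensional model and a
  finite-dimensional coefficient space `F`** (Bott–Tu (1982), Prop. 5.3.1; Lee (2013),
  Problem 18-8 / Thm. 17.20; Warner (1983), Cor. to Thm. 6.11 without harmonic theory).

## References

* R. Bott, L. W. Tu, *Differential Forms in Algebraic Topology* (1982), Prop. 5.3.1.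
* J. M. Lee, *Introduction to Smooth Manifolds*, 2nd ed. (2013), Thm. 17.20, Thm. 18.14.
* F. W. Warner, *Foundations of Differentiable Manifolds and Lie Groups* (1983), 6.11.
-/

noncomputable section

open scoped Manifold ContDiff Topology
open Bundle Set Filter

namespace Literature.Geometry.Kaehler

variable {E : Type*} [NormedAddCommGroup E] [NormedSpace ℝ E]
  {H : Type*} [TopologicalSpace H] {I : ModelWithCorners ℝ E H}
  {M : Type*} [TopologicalSpace M] [ChartedSpace H M]
  {F : Type*} [NormedAddCommGroup F] [NormedSpace ℝ F] {k : ℕ}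

section Union

variable [IsManifold I ∞ M]

/-- The empty set is relatively finite. [folklore] -/
theorem relFinite_empty : RelFinite I F (∅ : Set M) := by
  intro W' hW' hW'e W hW _ hKW' k
  have hW'0 : W' = ∅ := subset_empty_iff.1 hW'e
  haveI : Module.Finite ℝ (LocalDeRham I F k hW') :=
    finite_localDeRham_congr isOpen_empty hW' hW'0.symm finite_localDeRham_empty
  exact Module.Finite.range _

/-- The image of `H^k(W') → H^k(A)` is finite-dimensional as soon as `A` is relatively compact in
some open `A₀` with `A ⊆ A₀ ⊆ W'` and `A₀` relatively finite (factor through `H^k(A₀)`).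
[folklore] -/
theorem finite_range_res_of_relFinite {U A₀ A W' : Set M} (hr : RelFinite I F U) (hA₀ : IsOpen A₀)
    (hA₀U : A₀ ⊆ U) (hA : IsOpen A) (hW' : IsOpen W') (hAc : IsCompact (closure A))
    (hAA₀ : closure A ⊆ A₀) (hA₀W' : A₀ ⊆ W') (k : ℕ) :
    Module.Finite ℝ (LinearMap.range
      (LocalDeRham.res I F k hA hW' ((subset_closure.trans hAA₀).trans hA₀W'))) := by
  have h1 := hr hA₀ hA₀U hA hAc hAA₀ k
  have heq : LocalDeRham.res I F k hA hW' ((subset_closure.trans hAA₀).trans hA₀W') =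
      LocalDeRham.res I F k hA hA₀ (subset_closure.trans hAA₀) ∘ₗ LocalDeRham.res I F k hA₀ hW' hA₀W' := by
    apply LinearMap.ext
    intro c
    exact (LocalDeRham.res_comp hA hA₀ hW' _ hA₀W' c).symm
  rw [heq]
  exact finite_of_le (LinearMap.range_comp_le_range _ _) h1

variable [FiniteDimensional ℝ E] [T2Space M] [SecondCountableTopology M]

/-- **Relative finiteness passes to binary unions** ("three rows": shrink to `(A, B)` and again
to `(P, Q)`; classes dying on `A` and `B` are controlled on `P ∪ Q` by the connecting
homomorphism applied to the finite-dimensional image of `H(A ∩ B) → H(P ∩ Q)`). This is the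
step replacing good covers in Bott–Tu (1982), Prop. 5.3.1. [cite: BottTu1982Forms, Prop. 5.3.1] -/
theorem RelFinite.union {U V : Set M} (hU : IsOpen U) (hV : IsOpen V) (hrU : RelFinite I F U)
    (hrV : RelFinite I F V) : RelFinite I F (U ∪ V) := by
  haveI : LocallyCompactSpace M := Manifold.locallyCompact_of_finiteDimensional I
  intro W' hW' hW'UV W hW hKc hKW' k
  -- row 1: `A₀ = W' ∩ U`, `B₀ = W' ∩ V`
  have hA₀ : IsOpen (W' ∩ U) := hW'.inter hU
  have hB₀ : IsOpen (W' ∩ V) := hW'.inter hV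
  have hK : closure W ⊆ W' ∩ U ∪ W' ∩ V := by
    rw [← inter_union_distrib_left]
    exact fun x hx ↦ ⟨hKW' hx, hW'UV (hKW' hx)⟩
  obtain ⟨K₁, K₂, hK₁c, hK₂c, hK₁A, hK₂B, hKeq⟩ := hKc.binary_compact_cover hA₀ hB₀ hK
  -- row 2: `A`, `B` with compact closures in `A₀`, `B₀`
  obtain ⟨A, hAo, hK₁A', hAcl, hAc⟩ := exists_open_between_and_isCompact_closure hK₁c hA₀ hK₁A
  obtain ⟨B, hBo, hK₂B', hBcl, hBc⟩ := exists_open_between_and_isCompact_closure hK₂c hB₀ hK₂B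
  -- row 3: `P`, `Q` with compact closures in `A`, `B`
  obtain ⟨P, hPo, hK₁P, hPcl, hPc⟩ := exists_open_between_and_isCompact_closure hK₁c hAo hK₁A'
  obtain ⟨Q, hQo, hK₂Q, hQcl, hQc⟩ := exists_open_between_and_isCompact_closure hK₂c hBo hK₂B'
  have hPA : P ⊆ A := subset_closure.trans hPcl
  have hQB : Q ⊆ B := subset_closure.trans hQcl
  have hAW' : A ⊆ W' := fun x hx ↦ (hAcl (subset_closure hx)).1
  have hBW' : B ⊆ W' := fun x hx ↦ (hBcl (subset_closure hx)).1
  have hAU : A ⊆ U := fun x hx ↦ (hAcl (subset_closure hx)).2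
  have hBV : B ⊆ V := fun x hx ↦ (hBcl (subset_closure hx)).2
  have hABW' : A ∪ B ⊆ W' := union_subset hAW' hBW'
  have hPQAB : P ∪ Q ⊆ A ∪ B := union_subset_union hPA hQB
  have hWPQ : W ⊆ P ∪ Q := fun x hx ↦ by
    have h := (hKeq ▸ subset_closure hx : x ∈ K₁ ∪ K₂)
    exact h.elim (fun h ↦ Or.inl (hK₁P h)) (fun h ↦ Or.inr (hK₂Q h))
  obtain ⟨b⟩ := exists_bumpPair (I := I) hPo hQo
  -- the restrictions to `A` and `B`, with finite-dimensional images
  set rA := LocalDeRham.res I F k hAo hW' hAW' with hrA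
  set rB := LocalDeRham.res I F k hBo hW' hBW' with hrB
  haveI hfA : Module.Finite ℝ (LinearMap.range rA) :=
    finite_range_res_of_relFinite hrU hA₀ inter_subset_right hAo hW' hAc hAcl inter_subset_left k
  haveI hfB : Module.Finite ℝ (LinearMap.range rB) :=
    finite_range_res_of_relFinite hrV hB₀ inter_subset_right hBo hW' hBc hBcl inter_subset_left k
  set g : LocalDeRham I F k hW' →ₗ[ℝ] LinearMap.range rA × LinearMap.range rB :=
    rA.rangeRestrict.prod rB.rangeRestrict with hg
  have hgker : ∀ c, c ∈ LinearMap.ker g ↔ rA c = 0 ∧ rB c = 0 := fun c ↦ by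
    rw [LinearMap.mem_ker, hg]
    simp [Prod.ext_iff, Subtype.ext_iff]
  -- finite codimension of `ker g`
  have hQfin : Module.Finite ℝ (LocalDeRham I F k hW' ⧸ LinearMap.ker g) :=
    Module.Finite.equiv g.quotKerEquivRange.symm
  -- the restriction to `W` and the image of `ker g`
  set r := LocalDeRham.res I F k hW hW' ((hWPQ.trans hPQAB).trans hABW') with hr
  have hfactor : ∀ c, r c = LocalDeRham.res I F k hW (hPo.union hQo) hWPQ
      (LocalDeRham.res I F k (hPo.union hQo) (hAo.union hBo) hPQAB
        (LocalDeRham.res I F k (hAo.union hBo) hW' hABW' c)) := fun c ↦ by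
    rw [hr, LocalDeRham.res_comp, LocalDeRham.res_comp]
  have hdies : ∀ c ∈ LinearMap.ker g,
      LocalDeRham.res I F k hAo (hAo.union hBo) subset_union_left
          (LocalDeRham.res I F k (hAo.union hBo) hW' hABW' c) = 0 ∧
        LocalDeRham.res I F k hBo (hAo.union hBo) subset_union_right
          (LocalDeRham.res I F k (hAo.union hBo) hW' hABW' c) = 0 := fun c hc ↦ by
    rw [LocalDeRham.res_comp, LocalDeRham.res_comp]
    exact (hgker c).1 hc
  have hNfin : Module.Finite ℝ ((LinearMap.ker g).map r) := by
    cases k with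
    | zero =>
      have hbot : (LinearMap.ker g).map r = ⊥ := by
        refine (Submodule.eq_bot_iff _).2 ?_
        rintro _ ⟨c, hc, rfl⟩
        rw [hfactor, LocalDeRham.eq_zero_of_res_eq_zero hAo hBo (hdies c hc).1 (hdies c hc).2, map_zero,
          map_zero]
      rw [hbot]
      exact Module.Finite.of_finite
    | succ j =>
      -- the finite-dimensional image of `H^j(A ∩ B) → H^j(P ∩ Q)` (relative finiteness of `U`)
      have hPQc : IsCompact (closure (P ∩ Q)) :=
        hPc.of_isClosed_subset isClosed_closure (closure_mono inter_subset_left)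
      have hPQcl : closure (P ∩ Q) ⊆ A ∩ B := fun x hx ↦
        ⟨hPcl (closure_mono inter_subset_left hx), hQcl (closure_mono inter_subset_right hx)⟩
      set r' := LocalDeRham.res I F j (hPo.inter hQo) (hAo.inter hBo) (inter_subset_inter hPA hQB) with hr'
      haveI hfr' : Module.Finite ℝ (LinearMap.range r') :=
        hrU (hAo.inter hBo) (inter_subset_left.trans hAU) (hPo.inter hQo) hPQc hPQcl j
      set T : Submodule ℝ (LocalDeRham I F (j + 1) hW) :=
        ((LinearMap.range r').map (LocalDeRham.delta hPo hQo b)).map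
          (LocalDeRham.res I F (j + 1) hW (hPo.union hQo) hWPQ) with hT
      have hTfin : Module.Finite ℝ T := by rw [hT]; infer_instance
      refine finite_of_le ?_ hTfin
      rintro _ ⟨c, hc, rfl⟩
      obtain ⟨c', hc'⟩ := LocalDeRham.exists_delta_eq_res hAo hBo hPo hQo hPA hQB b (hdies c hc).1 (hdies c hc).2
      rw [hfactor, hc', hT]
      exact Submodule.mem_map_of_mem (Submodule.mem_map_of_mem (LinearMap.mem_range_self r' c'))
  exact finite_range_of_finite_quotient_of_finite_map r (LinearMap.ker g) hQfin hNfin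

end Union

/-! ### Compact manifolds -/

section Compact

variable [FiniteDimensional ℝ E] [FiniteDimensional ℝ F] [IsManifold I ∞ M] [I.Boundaryless] [T2Space M]

/-- A finite union of chart sources is relatively finite. [folklore] -/
theorem relFinite_biUnion_source [SecondCountableTopology M] (t : Finset M) :
    RelFinite I F (⋃ x ∈ t, (extChartAt I x).source) := by
  classical
  induction t using Finset.induction_on with
  | empty =>
    have h : (⋃ x ∈ (∅ : Finset M), (extChartAt I x).source) = ∅ := by simp
    rw [h]
    exact relFinite_empty
  | insert a s _ ih =>
    rw [Finset.set_biUnion_insert]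
    exact RelFinite.union (isOpen_extChartAt_source a)
      (isOpen_biUnion fun x _ ↦ isOpen_extChartAt_source x)
      (relFinite_of_subset_source a subset_rfl) ih

/-- **A compact manifold is relatively finite** (finite union of chart sources). [folklore] -/
theorem relFinite_univ [SecondCountableTopology M] [CompactSpace M] : RelFinite I F (univ : Set M) := by
  obtain ⟨t, ht⟩ := isCompact_univ.elim_finite_subcover (fun x : M ↦ (extChartAt I x).source)
    (fun x ↦ isOpen_extChartAt_source x) (fun x _ ↦ mem_iUnion.2 ⟨x, mem_extChartAt_source x⟩)
  have h : (⋃ x ∈ t, (extChartAt I x).source) = univ := univ_subset_iff.1 ht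
  rw [← h]
  exact relFinite_biUnion_source t

/-- The local de Rham cohomology of `univ` of a compact manifold is finite-dimensional.
[cite: BottTu1982Forms, Prop. 5.3.1] -/
theorem finite_localDeRham_univ [SecondCountableTopology M] [CompactSpace M] (k : ℕ) :
    Module.Finite ℝ (LocalDeRham I F k (isOpen_univ : IsOpen (univ : Set M))) := by
  have hc : IsCompact (closure (univ : Set M)) := by rw [closure_univ]; exact isCompact_univ
  have hcl : closure (univ : Set M) ⊆ univ := subset_univ _
  haveI h := relFinite_univ (I := I) (F := F) isOpen_univ subset_rfl isOpen_univ hc hcl k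
  have hr : LinearMap.range (LocalDeRham.res I F k isOpen_univ isOpen_univ (subset_closure.trans hcl)) = ⊤ :=
    LinearMap.range_eq_top.2 fun c ↦ ⟨c, LocalDeRham.res_self _ c⟩
  rw [hr] at h
  exact Module.Finite.equiv (Submodule.topEquiv : (⊤ : Submodule ℝ (LocalDeRham I F k _)) ≃ₗ[ℝ] _)

variable (I M F) in
/-- **The de Rham cohomology of a compact manifold is finite-dimensional.** For a compact
Hausdorff boundaryless `C^∞` manifold `M` on a finite-dimensional real model and a
finite-dimensional coefficient space `F`, `H^k_dR(M; F) = deRhamCohomology I M F k` (closed smooth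
`k`-forms modulo exact ones, `Literature.Geometry.Kaehler.ManifoldForms`) is a finite-dimensional
real vector space, for every `k`. Proof: Mayer–Vietoris and the Poincaré lemma in charts, via the
relative finiteness property (this file and `DeRhamFiniteUnion`); metric-free, no good covers,
no harmonic theory. Bott–Tu (1982), Prop. 5.3.1; Warner (1983), Corollary to Thm. 6.11; Lee
(2013), Problem 18-8. [cite: BottTu1982Forms, Prop. 5.3.1] -/
theorem moduleFinite_deRhamCohomology_of_compactSpace [CompactSpace M] (k : ℕ) :
    Module.Finite ℝ (deRhamCohomology I M F k) := by
  haveI : SecondCountableTopology H := I.secondCountableTopology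
  haveI : SecondCountableTopology M := ChartedSpace.secondCountable_of_sigmaCompact H M
  exact finite_deRhamCohomology_of_finite_localDeRham_univ M (finite_localDeRham_univ k)

end Compact

end Literature.Geometry.Kaehler
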